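import Summits.QuantumAdvantage.AdviceFreeQNC0.TensorBlocksFixed
import Summits.QuantumAdvantage.AdviceFreeQNC0.EliminationLogDegree
import HarnessLib

/-!
# Cell qa-qnc0 (rung F-Q1, crux α `RingToElim` / density axis, crux of record `TensorMultOneAt`):
# the COSET-LEADER WEIGHT modulo the `k`-block degree-`1` sum code (toolkit for the LP rung of MULT₁)

Planner qa-qnc0-p1 gen 13 (`HOME/qa-qnc0-p1/ROUND-12.md` §2.10, `Sketch13.lean` v4, fence F12.4).  For
the norm-agnostic last-block induction (`TensorLPInduction.lean`) one needs an exponent-`2` group with a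
subadditive weight in which the `k`-block sum code `S_k(m,1)` (Sketch13 `SumCodeWin (m·k) k 1`) is
invisible: `Q = 𝔽₂^{{0,1}^{mk}}` (`CubeFn (ZMod 2) (m·k)`) with

* `TensorLP.cnorm m k f = min_{w ∈ S_k} #{u : f u ≠ w u}` — the coset-leader weight of `f` modulo
  the sum code; `cnorm_le`, `exists_eq_cnorm`, and **`cnorm_add_le`** (subadditivity: coset leaders
  add because the sum code is closed under `xor`, `sumCodeWin_xor` / `isBlockElim_xor`);
* `TensorLP.ndis f w` (disagreements with a Boolean pattern; `ndis 1 w = failCount w`) and the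
  `𝔽₂`-indicator bookkeeping `ι`, `ι_decide_card` (parity bit of a filtered count = `𝔽₂`-sum),
  `decide_range_succ` (splitting the last summand of a `k+1`-block parity).

The cell's lemmas (not in print).  WHAT THIS IS NOT: no statement about MULT₁; nothing on α;
separation NOT moved.
-/

noncomputable section

namespace Summit.QuantumAdvantage.AdviceFreeQNC0

open Finset
open Literature.Computability.MetaComplexity Literature.Computability.MetaComplexity.Smolensky

namespace TensorLP

/-! ### `𝔽₂`-indicators and parities -/

/-- The `𝔽₂`-indicator of a bit. -/
def ι (b : Bool) : ZMod 2 := if b then 1 else 0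

/-- `ι true = 1`. -/
@[simp] theorem ι_true : ι true = 1 := rfl

/-- `ι false = 0`. -/
@[simp] theorem ι_false : ι false = 0 := rfl

/-- `ι (a ⊕ b) = ι a + ι b`. -/
theorem ι_xor (a b : Bool) : ι (xor a b) = ι a + ι b := by
  cases a <;> cases b <;> decide

/-- `ι` is injective. -/
theorem ι_injective : Function.Injective ι := by
  intro a b h; cases a <;> cases b <;> first | rfl | exact absurd h (by decide)

/-- `1 + ι a ≠ ι b ↔ a = b`. -/
theorem one_add_ι_ne_iff (a b : Bool) : 1 + ι a ≠ ι b ↔ a = b := by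
  cases a <;> cases b <;> decide

/-- `ι a + ι b + ι c = ι (a ⊕ (b ⊕ c))`. -/
theorem ι_add3 (a b c : Bool) : ι a + ι b + ι c = ι (xor a (xor b c)) := by
  cases a <;> cases b <;> cases c <;> decide

/-- In `𝔽₂`, `a + b + c = 0 → c = a + b`. -/
theorem eq_add_of_sum3 : ∀ {a b c : ZMod 2}, a + b + c = 0 → c = a + b := by decide

/-- The parity bit of a filtered count is the `𝔽₂`-sum of the indicators. -/
theorem ι_decide_card {α : Type*} (s : Finset α) (p : α → Bool) :
    ι (decide ((s.filter fun j => p j = true).card % 2 = 1)) = ∑ j ∈ s, ι (p j) := by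
  have h1 : (∑ j ∈ s, ι (p j)) = ((s.filter fun j => p j = true).card : ZMod 2) := by
    rw [Finset.card_filter, Nat.cast_sum]
    refine sum_congr rfl fun j _ => ?_
    unfold ι; split_ifs <;> simp
  rw [h1]
  set c := (s.filter fun j => p j = true).card
  rw [← ZMod.natCast_mod c 2]
  rcases Nat.mod_two_eq_zero_or_one c with h | h <;> rw [h] <;> simp [ι]

/-- Splitting off the last index of a parity of a count over `range (k+1)`. -/
theorem decide_range_succ (k : ℕ) (P : ℕ → Bool) :
    decide (((range (k + 1)).filter fun j => P j = true).card % 2 = 1) =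
      xor (decide (((range k).filter fun j => P j = true).card % 2 = 1)) (P k) := by
  apply ι_injective
  rw [ι_xor, ι_decide_card, ι_decide_card, sum_range_succ]

/-! ### Disagreement counts and the coset-leader weight modulo the sum code -/

variable {n : ℕ}

/-- Number of inputs where `f : 𝔽₂^{{0,1}ⁿ}` disagrees with the indicator of the pattern `w`. -/
def ndis (f : CubeFn (ZMod 2) n) (w : (Fin n → Bool) → Bool) : ℕ :=
  (univ.filter fun u : Fin n → Bool => f u ≠ ι (w u)).card

/-- Disagreements are subadditive under `(f, w), (g, w') ↦ (f + g, w ⊕ w')`. -/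
theorem ndis_add_le (f g : CubeFn (ZMod 2) n) (w w' : (Fin n → Bool) → Bool) :
    ndis (f + g) (fun u => xor (w u) (w' u)) ≤ ndis f w + ndis g w' := by
  unfold ndis
  refine (card_le_card ?_).trans (card_union_le _ _)
  intro u hu
  simp only [mem_filter, mem_univ, true_and, mem_union] at hu ⊢
  by_contra h
  simp only [not_or, ne_eq, not_not] at h
  exact hu (by rw [Pi.add_apply, h.1, h.2, ι_xor])

/-- Disagreements of the constant `𝟙` with `w` = the failures of `w`. -/
theorem ndis_one (w : (Fin n → Bool) → Bool) : ndis 1 w = failCount w := by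
  unfold ndis failCount
  congr 1; ext u
  simp only [mem_filter, mem_univ, true_and, Pi.one_apply]
  cases w u <;> decide

/-- Even triples of block-degree `≤ t` are closed under `xor`. -/
theorem isBlockElim_xor {k j t : ℕ} {X Y : (Fin n → Bool) → Bool}
    (hX : IsBlockElim n k j t X) (hY : IsBlockElim n k j t Y) :
    IsBlockElim n k j t (fun u => xor (X u) (Y u)) := by
  obtain ⟨T, hT, hTe, hTX⟩ := hX
  obtain ⟨S, hS, hSe, hSY⟩ := hY
  refine ⟨fun r u => xor (T r u) (S r u), fun r v => hasDeg_xor (hT r v) (hS r v), fun u => ?_,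
    fun u => by beta_reduce; rw [hTX, hSY]⟩
  apply ι_injective
  have h1 := congrArg ι (hTe u)
  have h2 := congrArg ι (hSe u)
  simp only [ι_xor, ι_false] at h1 h2 ⊢
  calc ι (T 0 u) + ι (S 0 u) + (ι (T 1 u) + ι (S 1 u) + (ι (T 2 u) + ι (S 2 u)))
      = (ι (T 0 u) + (ι (T 1 u) + ι (T 2 u))) + (ι (S 0 u) + (ι (S 1 u) + ι (S 2 u))) := by ring
    _ = 0 := by rw [h1, h2, add_zero]

/-- The sum code is closed under `xor`. -/
theorem sumCodeWin_xor {k t : ℕ} {w w' : (Fin n → Bool) → Bool}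
    (hw : SumCodeWin n k t w) (hw' : SumCodeWin n k t w') :
    SumCodeWin n k t (fun u => xor (w u) (w' u)) := by
  obtain ⟨X, hX, hw⟩ := hw
  obtain ⟨Y, hY, hw'⟩ := hw'
  refine ⟨fun j u => xor (X j u) (Y j u), fun j hj => isBlockElim_xor (hX j hj) (hY j hj), fun u => ?_⟩
  beta_reduce
  rw [hw u, hw' u]
  apply ι_injective
  rw [ι_xor, ι_decide_card, ι_decide_card, ι_decide_card, ← sum_add_distrib]
  exact sum_congr rfl fun j _ => (ι_xor _ _).symm

section Code

open scoped Classical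

variable (m k : ℕ)

/-- The `k`-block degree-`1` sum code `S_k(m,1)` on `{0,1}^{mk}` as a finset of patterns. -/
def code : Finset ((Fin (m * k) → Bool) → Bool) := univ.filter fun w => SumCodeWin (m * k) k 1 w

/-- Membership in `code`. -/
theorem mem_code {w : (Fin (m * k) → Bool) → Bool} : w ∈ code m k ↔ SumCodeWin (m * k) k 1 w := by
  unfold code
  rw [mem_filter]
  exact ⟨fun h => h.2, fun h => ⟨mem_univ _, h⟩⟩

/-- The zero pattern lies in the sum code. -/
theorem zero_mem_code : (fun _ => false) ∈ code m k := by
  rw [mem_code]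
  refine ⟨fun _ _ => false, fun j _ => ⟨fun _ _ => false, fun r v => ?_, fun u => rfl, fun u => rfl⟩,
    fun u => by simp⟩
  show (fun x : Fin (m * k) → Bool => if false = true then (1 : ZMod 2) else 0) ∈ _
  have : (fun x : Fin (m * k) → Bool => if false = true then (1 : ZMod 2) else 0) = 0 := by
    funext x; simp
  rw [this]
  exact Submodule.zero_mem _

/-- The sum code is nonempty. -/
theorem code_nonempty : (code m k).Nonempty := ⟨_, zero_mem_code m k⟩

/-- COSET-LEADER WEIGHT modulo the sum code: `cnorm f = min_{w ∈ S_k} #{u : f u ≠ w u}`. -/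
def cnorm (f : CubeFn (ZMod 2) (m * k)) : ℕ :=
  ((code m k).image (ndis f)).min' ((code_nonempty m k).image _)

/-- `cnorm f` is at most the disagreement count with any code pattern. -/
theorem cnorm_le {f : CubeFn (ZMod 2) (m * k)} {w : (Fin (m * k) → Bool) → Bool}
    (hw : SumCodeWin (m * k) k 1 w) : cnorm m k f ≤ ndis f w :=
  min'_le _ _ (mem_image_of_mem _ ((mem_code m k).2 hw))

/-- `cnorm f` is attained by some code pattern (a coset leader). -/
theorem exists_eq_cnorm (f : CubeFn (ZMod 2) (m * k)) :
    ∃ w, SumCodeWin (m * k) k 1 w ∧ ndis f w = cnorm m k f := by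
  obtain ⟨w, hw, h⟩ := mem_image.1 (min'_mem ((code m k).image (ndis f)) ((code_nonempty m k).image _))
  exact ⟨w, (mem_code m k).1 hw, h⟩

/-- The coset-leader weight is subadditive (leaders add; the code is `xor`-closed). -/
theorem cnorm_add_le (f g : CubeFn (ZMod 2) (m * k)) :
    cnorm m k (f + g) ≤ cnorm m k f + cnorm m k g := by
  obtain ⟨w, hw, hf⟩ := exists_eq_cnorm m k f
  obtain ⟨w', hw', hg⟩ := exists_eq_cnorm m k g
  calc cnorm m k (f + g) ≤ ndis (f + g) (fun u => xor (w u) (w' u)) := cnorm_le m k (sumCodeWin_xor hw hw')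
    _ ≤ ndis f w + ndis g w' := ndis_add_le _ _ _ _
    _ = _ := by rw [hf, hg]

end Code


end TensorLP

end Summit.QuantumAdvantage.AdviceFreeQNC0
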